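import Summits.QuantumFields.YangMills.Theorems.AllWindowsColdBoxBoxHighLineRestInvDecay

/-!
# LINE-19 S3b / LINE-20 U1 — STUB-PLAN-U1 §7.4 input (h3), part 1: skin rows and the two-sided rest kernel

Machinery for the last block input (h3) (`(1+d)⁻⁴` decay of the skin Schur complement `schurSkin`) of
`RestBlock.landauKernelBounds_of_inputs`:

* `skinRow y μ g` — the row of `hodgeQ` at a SKIN link `(y, μ)` applied to an edge function `g` of `ℤ⁴`: the six plaquette circulations
  (`hodgeQ_mulVec_skin`, from `hodgeQ_mulVec_apply`; no gauge terms at a skin link); it is linear (`skinRow_sub`) and obeys the weighted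
  bound `skinRow_bound` as soon as every circulation near `y` does;
* `Kx i z w = [z rest]·[w rest]·G_B^{(i)}(z, w)` — the rest × rest kernel of direction `i` on all integer points, and the FILL-IN lemmas
  `fill_fst` / `fill_snd`: next to a transverse Dirichlet face the indicator may be dropped because the ghost entry vanishes;
* **`Kx_hessian_bound`** — the mixed second difference of `Kx` (one transverse step in each slot) is bounded by `C·(1 + |z_κ − w_κ|)⁻⁴`
  (`BoxKernel.boxGreen_hessian_decay_shift`).

Everything proved; standard axioms.  HONEST LABEL: bookkeeping toward stub S3 (⟨stmt-QuantumFields-24004⟩/⟨24335⟩; U1 of ⟨24336⟩); S3 is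
NOT closed by this file; no crux, rung or summit is proved; the Yang–Mills mass gap is NOT proved here.
-/

set_option autoImplicit false

noncomputable section

namespace Summit.QuantumFields.YangMills.Theorems.AllWindowsColdBoxBoxHighLine

open Finset Matrix
open Literature.Probability.LatticeModels (Site)
open Literature.MathematicalPhysics.QuantumFieldTheory
open Literature.MathematicalPhysics.QuantumFieldTheory.LatticeMaxwell
open Literature.MathematicalPhysics.QuantumFieldTheory.AxialGauge
open Summit.QuantumFields.YangMills.Theorems.WeakCouplingRates
open Summit.QuantumFields.YangMills.Theorems.AllWindowsColdBox.BoxKernel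

namespace RestBlock

variable {H : ℕ}

/-! ## The row of `hodgeQ` at a skin link -/

/-- The circulation of an edge function around the plaquette `(z; i, j)`. -/
def circ (g : Literature.MathematicalPhysics.QuantumLattice.ZdEdge 4 → ℝ) (z : Site 4) (i j : Fin 4) : ℝ :=
  g (z, i) + g (z + Pi.single i 1, j) - g (z + Pi.single j 1, i) - g (z, j)

/-- The row of `hodgeQ` at a skin link `(y, μ)`, as a functional of an edge function of `ℤ⁴`: the six plaquette circulations. -/
def skinRow (y : Site 4) (μ : Fin 4) (g : Literature.MathematicalPhysics.QuantumLattice.ZdEdge 4 → ℝ) : ℝ :=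
  (∑ ν : Fin 4, if μ < ν then circ g y μ ν - circ g (y - Pi.single ν 1) μ ν else 0) +
    ∑ ν : Fin 4, if ν < μ then circ g (y - Pi.single ν 1) ν μ - circ g y ν μ else 0

/-- **The row of `hodgeQ` at a skin link** applied to `w` is `skinRow` of the zero extension of `w` (no gauge terms: both endpoints are
wall sites). -/
theorem hodgeQ_mulVec_skin (s : Skin H) (w : LandauFree H → ℝ) (g : Literature.MathematicalPhysics.QuantumLattice.ZdEdge 4 → ℝ)
    (hg : g = glue (pin := landauPin H) dirCorner (2 * H + 3) 0 w) :
    (hodgeQ H *ᵥ w) s.1 = skinRow s.1.1.1.1 s.1.1.1.2 g := by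
  rw [hodgeQ_mulVec_apply w s.1 g hg]
  have hs1 : s.1.1.1.1 + Pi.single s.1.1.1.2 1 ∉ interiorSites H := fun h => s.2 (Or.inr h)
  have hs2 : s.1.1.1.1 ∉ interiorSites H := fun h => s.2 (Or.inl h)
  rw [if_neg hs1, if_neg hs2, sub_self, add_zero]
  simp only [skinRow, circ, sub_add_cancel]

/-- `skinRow` is linear: differences. -/
theorem skinRow_sub (y : Site 4) (μ : Fin 4) (g₁ g₂ : Literature.MathematicalPhysics.QuantumLattice.ZdEdge 4 → ℝ) :
    skinRow y μ (fun f => g₁ f - g₂ f) = skinRow y μ g₁ - skinRow y μ g₂ := by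
  simp only [skinRow, circ]
  rw [add_sub_add_comm, ← Finset.sum_sub_distrib, ← Finset.sum_sub_distrib]
  congr 1 <;> refine Finset.sum_congr rfl fun ν _ => ?_ <;> split_ifs <;> ring

/-- **Weighted bound for a skin row from a bound on the circulations near the base point** (`16` terms). -/
theorem skinRow_bound (y : Site 4) (μ : Fin 4) (g : Literature.MathematicalPhysics.QuantumLattice.ZdEdge 4 → ℝ) (W c : ℝ)
    (hW : 0 ≤ W) (hc : 0 ≤ c)
    (hcirc : ∀ (z : Site 4) (i j : Fin 4), i ≠ j → (∀ κ, |z κ - y κ| ≤ 1) → |circ g z i j| * W ≤ c) :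
    |skinRow y μ g| * W ≤ 16 * c := by
  have hy0 : ∀ κ, |y κ - y κ| ≤ 1 := fun κ => by simp
  have hy1 : ∀ ν κ, |(y - Pi.single ν 1 : Site 4) κ - y κ| ≤ 1 := by
    intro ν κ; simp only [Pi.sub_apply, Pi.single_apply]; split_ifs <;> simp
  have hA : ∀ ν : Fin 4, |(if μ < ν then circ g y μ ν - circ g (y - Pi.single ν 1) μ ν else 0)| * W ≤ 2 * c := by
    intro ν
    by_cases hlt : μ < ν
    · rw [if_pos hlt]
      have h1 := hcirc y μ ν (ne_of_lt hlt) hy0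
      have h2 := hcirc (y - Pi.single ν 1) μ ν (ne_of_lt hlt) (hy1 ν)
      have h3 := mul_le_mul_of_nonneg_right (abs_sub (circ g y μ ν) (circ g (y - Pi.single ν 1) μ ν)) hW
      rw [add_mul] at h3
      linarith
    · rw [if_neg hlt, abs_zero, zero_mul]; positivity
  have hB : ∀ ν : Fin 4, |(if ν < μ then circ g (y - Pi.single ν 1) ν μ - circ g y ν μ else 0)| * W ≤ 2 * c := by
    intro ν
    by_cases hlt : ν < μ
    · rw [if_pos hlt]
      have h1 := hcirc (y - Pi.single ν 1) ν μ (ne_of_lt hlt) (hy1 ν)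
      have h2 := hcirc y ν μ (ne_of_lt hlt) hy0
      have h3 := mul_le_mul_of_nonneg_right (abs_sub (circ g (y - Pi.single ν 1) ν μ) (circ g y ν μ)) hW
      rw [add_mul] at h3
      linarith
    · rw [if_neg hlt, abs_zero, zero_mul]; positivity
  have hfin := abs_sum_add_sum_mul_le _ _ W (2 * c) hW hA hB
  simp only [Fintype.card_fin] at hfin
  unfold skinRow
  exact hfin.trans (by push_cast; linarith)

/-! ## The two-sided rest kernel of a direction on all integer points -/

variable (H) in
/-- The rest indicator of `(a, i)` as a real number. -/
def rind (i : Fin 4) (a : Site 4) : ℝ := by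
  classical
  exact if IsRest H a i then 1 else 0

/-- `rind = 1` on rest links. -/
theorem rind_of_isRest {i : Fin 4} {a : Site 4} (h : IsRest H a i) : rind H i a = 1 := by
  unfold rind; rw [if_pos h]

/-- `rind = 0` off rest links. -/
theorem rind_of_not_isRest {i : Fin 4} {a : Site 4} (h : ¬ IsRest H a i) : rind H i a = 0 := by
  unfold rind; rw [if_neg h]

/-- `|rind| ≤ 1`. -/
theorem abs_rind_le (i : Fin 4) (a : Site 4) : |rind H i a| ≤ 1 := by
  by_cases h : IsRest H a i
  · rw [rind_of_isRest h]; simp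
  · rw [rind_of_not_isRest h]; simp

variable (H) in
/-- **The rest × rest kernel of direction `i` on all integer points**: `[a rest]·[b rest]·G_B^{(i)}(a, b)`, `G_B^{(i)}` the box Green
function with Dirichlet faces transverse to `i` and Neumann faces in the direction `i`. -/
def Kx [NeZero (2 * H)] (i : Fin 4) (a b : Site 4) : ℝ := rind H i a * (rind H i b * boxGreen (2 * H) (univ.erase i) a b)

/-- The kernel column `restKer` of a rest link is the two-sided kernel of its direction. -/
theorem restKer_eq_Kx [NeZero (2 * H)] (r : Rest H) (b : Site 4) : restKer r b = Kx H r.1.1.1.2 r.1.1.1.1 b := by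
  unfold Kx
  rw [rind_of_isRest (isRest_rest r), one_mul]
  by_cases hb : IsRest H b r.1.1.1.2
  · rw [restKer_of_isRest r hb, rind_of_isRest hb, one_mul]
  · rw [restKer_of_not_isRest r hb, rind_of_not_isRest hb, zero_mul]

/-- `Kx` vanishes if the first point is not a rest link. -/
theorem Kx_of_not_isRest_fst [NeZero (2 * H)] {i : Fin 4} {a : Site 4} (h : ¬ IsRest H a i) (b : Site 4) : Kx H i a b = 0 := by
  unfold Kx; rw [rind_of_not_isRest h, zero_mul]

/-- `Kx` vanishes if the second point is not a rest link. -/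
theorem Kx_of_not_isRest_snd [NeZero (2 * H)] {i : Fin 4} (a : Site 4) {b : Site 4} (h : ¬ IsRest H b i) : Kx H i a b = 0 := by
  unfold Kx; rw [rind_of_not_isRest h, zero_mul, mul_zero]

/-- **Fill-in next to a transverse face (first slot)**: if one of `a`, `a + e_j` (`j ≠ i`) is a rest link of direction `i`, the rest
indicators of both may be dropped in front of `G_B^{(i)}(·, b)` — the non-rest one is a Dirichlet ghost row. -/
theorem fill_fst [NeZero (2 * H)] {i j : Fin 4} (hj : j ≠ i) {a : Site 4} (h : IsRest H a i ∨ IsRest H (a + Pi.single j 1) i)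
    (b : Site 4) :
    rind H i a * boxGreen (2 * H) (univ.erase i) a b = boxGreen (2 * H) (univ.erase i) a b ∧
      rind H i (a + Pi.single j 1) * boxGreen (2 * H) (univ.erase i) (a + Pi.single j 1) b =
        boxGreen (2 * H) (univ.erase i) (a + Pi.single j 1) b := by
  have hjD : j ∈ Finset.univ.erase i := Finset.mem_erase.2 ⟨hj, Finset.mem_univ _⟩
  constructor
  · by_cases ha : IsRest H a i
    · rw [rind_of_isRest ha, one_mul]
    · have ha' : IsRest H (a + Pi.single j 1) i := h.resolve_left ha
      have h0 : a j = 0 := coord_eq_zero_of_isRest_add hj ha' ha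
      set t := toBox i (a + Pi.single j 1) ha' with ht
      have ht1 : (t.1 j : ℕ) = 1 := by
        have h1 : (t.1 j : ℕ) = ((a + Pi.single j 1 : Site 4) j).toNat := rfl
        have h2 : (a + Pi.single j 1 : Site 4) j = a j + 1 := by simp
        omega
      have hz : boxGreen (2 * H) (univ.erase i) a b = 0 := by
        have e1 : a = coords t - Pi.single j 1 := by rw [coords_toBox]; simp
        rw [e1]; exact boxGreen_dirichlet_bottom hjD t ht1 b
      rw [hz, mul_zero]
  · by_cases ha' : IsRest H (a + Pi.single j 1) i
    · rw [rind_of_isRest ha', one_mul]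
    · have ha : IsRest H a i := h.resolve_right ha'
      have h1 : a j = 2 * (H : ℤ) - 1 := coord_eq_of_isRest_not_add hj ha ha'
      set t := toBox i a ha with ht
      have ht1 : (t.1 j : ℕ) + 1 = 2 * H := by
        have : (t.1 j : ℕ) = (a j).toNat := rfl
        omega
      have hz : boxGreen (2 * H) (univ.erase i) (a + Pi.single j 1) b = 0 := by
        have e1 : a + Pi.single j 1 = coords t + Pi.single j 1 := by rw [coords_toBox]
        rw [e1]; exact boxGreen_dirichlet_top hjD t ht1 b
      rw [hz, mul_zero]

/-- **Fill-in next to a transverse face (second slot).** -/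
theorem fill_snd [NeZero (2 * H)] {i j : Fin 4} (hj : j ≠ i) {b : Site 4} (h : IsRest H b i ∨ IsRest H (b + Pi.single j 1) i)
    (a : Site 4) :
    rind H i b * boxGreen (2 * H) (univ.erase i) a b = boxGreen (2 * H) (univ.erase i) a b ∧
      rind H i (b + Pi.single j 1) * boxGreen (2 * H) (univ.erase i) a (b + Pi.single j 1) =
        boxGreen (2 * H) (univ.erase i) a (b + Pi.single j 1) := by
  have h1 := fill_fst hj h a
  rw [boxGreen_comm b a, boxGreen_comm (b + Pi.single j 1) a] at h1
  exact h1

/-- A box base point for a pair `z, z + e_j` one of which is a rest link: `z = s + t e_j` with `t ∈ {0, −1}`. -/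
theorem exists_box_base {i j : Fin 4} {z : Site 4} (h : IsRest H z i ∨ IsRest H (z + Pi.single j 1) i) :
    ∃ (s : Box 4 (2 * H) (univ.erase i)) (t : ℤ), (t = 0 ∨ t = -1) ∧ coords s + Pi.single j t = z := by
  rcases h with h | h
  · exact ⟨toBox i z h, 0, Or.inl rfl, by rw [coords_toBox]; simp⟩
  · refine ⟨toBox i (z + Pi.single j 1) h, -1, Or.inr rfl, ?_⟩
    rw [coords_toBox, add_assoc, ← Pi.single_add]; simp

/-- Moving both base points by at most two steps costs at most a factor `81` in the quartic weight. -/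
theorem weight4_shift_le {a b c d : ℝ} (h : |a - b| ≤ |c - d| + 2) : (1 + |a - b|) ^ 4 ≤ 81 * (1 + |c - d|) ^ 4 := by
  have h0 : 0 ≤ |c - d| := abs_nonneg _
  have h1 : 1 + |a - b| ≤ 3 * (1 + |c - d|) := by linarith
  calc (1 + |a - b|) ^ 4 ≤ (3 * (1 + |c - d|)) ^ 4 := pow_le_pow_left₀ (by positivity) h1 4
    _ = 81 * (1 + |c - d|) ^ 4 := by ring

/-- **The mixed second difference of the two-sided rest kernel** (one transverse step `e_j` in the first slot, one transverse step
`e_ν` in the second) **decays like `(1 + |z_κ − w_κ|)⁻⁴`.** -/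
theorem Kx_hessian_bound : ∃ C : ℝ, 0 ≤ C ∧ ∀ (H : ℕ) [NeZero (2 * H)] (i j ν κ : Fin 4), j ≠ i → ν ≠ i → ∀ (z w : Site 4),
    |Kx H i (z + Pi.single j 1) (w + Pi.single ν 1) - Kx H i (z + Pi.single j 1) w - Kx H i z (w + Pi.single ν 1) + Kx H i z w| *
      (1 + |((z κ - w κ : ℤ) : ℝ)|) ^ 4 ≤ C := by
  obtain ⟨C, hC0, hC⟩ := boxGreen_hessian_decay_shift
  refine ⟨81 * C, by positivity, ?_⟩
  intro H _ i j ν κ hj hν z w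
  by_cases hz : IsRest H z i ∨ IsRest H (z + Pi.single j 1) i
  · by_cases hw : IsRest H w i ∨ IsRest H (w + Pi.single ν 1) i
    · -- all four indicators may be dropped: a genuine Hessian of the box Green function
      have hK : ∀ a b : Site 4, (a = z ∨ a = z + Pi.single j 1) → (b = w ∨ b = w + Pi.single ν 1) →
          Kx H i a b = boxGreen (2 * H) (univ.erase i) a b := by
        intro a b ha hb
        unfold Kx
        have h2 : rind H i b * boxGreen (2 * H) (univ.erase i) a b = boxGreen (2 * H) (univ.erase i) a b := by
          rcases hb with rfl | rfl
          · exact (fill_snd hν hw a).1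
          · exact (fill_snd hν hw a).2
        rw [h2]
        rcases ha with rfl | rfl
        · exact (fill_fst hj hz b).1
        · exact (fill_fst hj hz b).2
      rw [hK _ _ (Or.inr rfl) (Or.inr rfl), hK _ _ (Or.inr rfl) (Or.inl rfl), hK _ _ (Or.inl rfl) (Or.inr rfl),
        hK _ _ (Or.inl rfl) (Or.inl rfl)]
      obtain ⟨s, t, ht, hs⟩ := exists_box_base hz
      obtain ⟨s', t', ht', hs'⟩ := exists_box_base hw
      have h := hC (2 * H) (univ.erase i) j ν κ t t' ht ht' s s'
      rw [hs, hs'] at h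
      -- compare the weights: `|z_κ − w_κ| ≤ |s_κ − s'_κ| + 2`
      have hzs : ((z κ : ℤ) : ℝ) = ((s.1 κ : ℕ) : ℝ) + (if κ = j then (t : ℝ) else 0) := by
        have := congrFun hs κ
        simp only [Pi.add_apply, Pi.single_apply, coords] at this
        rw [← this]; push_cast; split_ifs <;> simp
      have hws : ((w κ : ℤ) : ℝ) = ((s'.1 κ : ℕ) : ℝ) + (if κ = ν then (t' : ℝ) else 0) := by
        have := congrFun hs' κ
        simp only [Pi.add_apply, Pi.single_apply, coords] at this
        rw [← this]; push_cast; split_ifs <;> simp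
      have hwt : |((z κ : ℤ) : ℝ) - ((w κ : ℤ) : ℝ)| ≤ |(((s.1 κ : ℕ) : ℝ)) - ((s'.1 κ : ℕ) : ℝ)| + 2 := by
        rw [hzs, hws]
        have e1 : (((s.1 κ : ℕ) : ℝ) + (if κ = j then (t : ℝ) else 0)) - (((s'.1 κ : ℕ) : ℝ) + (if κ = ν then (t' : ℝ) else 0)) =
            ((((s.1 κ : ℕ) : ℝ)) - ((s'.1 κ : ℕ) : ℝ)) + ((if κ = j then (t : ℝ) else 0) - (if κ = ν then (t' : ℝ) else 0)) := by
          ring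
        rw [e1]
        have e2 : |(if κ = j then (t : ℝ) else 0) - (if κ = ν then (t' : ℝ) else 0)| ≤ 2 := by
          rcases ht with rfl | rfl <;> rcases ht' with rfl | rfl <;> split_ifs <;> norm_num
        have := abs_add_le ((((s.1 κ : ℕ) : ℝ)) - ((s'.1 κ : ℕ) : ℝ)) ((if κ = j then (t : ℝ) else 0) - (if κ = ν then (t' : ℝ) else 0))
        linarith
      have hW := weight4_shift_le hwt
      push_cast
      calc _ ≤ |boxGreen (2 * H) (univ.erase i) (z + Pi.single j 1) (w + Pi.single ν 1) -
              boxGreen (2 * H) (univ.erase i) (z + Pi.single j 1) w - boxGreen (2 * H) (univ.erase i) z (w + Pi.single ν 1) +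
              boxGreen (2 * H) (univ.erase i) z w| * (81 * (1 + |(((s.1 κ : ℕ) : ℝ)) - ((s'.1 κ : ℕ) : ℝ)|) ^ 4) :=
            mul_le_mul_of_nonneg_left hW (abs_nonneg _)
        _ = 81 * (|boxGreen (2 * H) (univ.erase i) (z + Pi.single j 1) (w + Pi.single ν 1) -
              boxGreen (2 * H) (univ.erase i) (z + Pi.single j 1) w - boxGreen (2 * H) (univ.erase i) z (w + Pi.single ν 1) +
              boxGreen (2 * H) (univ.erase i) z w| * (1 + |(((s.1 κ : ℕ) : ℝ)) - ((s'.1 κ : ℕ) : ℝ)|) ^ 4) := by ring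
        _ ≤ 81 * C := mul_le_mul_of_nonneg_left h (by norm_num)
    · -- neither `w` nor `w + e_ν` is a rest link: everything vanishes
      have hw1 : ¬ IsRest H w i := fun hc => hw (Or.inl hc)
      have hw2 : ¬ IsRest H (w + Pi.single ν 1) i := fun hc => hw (Or.inr hc)
      rw [Kx_of_not_isRest_snd _ hw2, Kx_of_not_isRest_snd _ hw1, Kx_of_not_isRest_snd _ hw2, Kx_of_not_isRest_snd _ hw1]
      simp only [sub_zero, add_zero, abs_zero, zero_mul]
      positivity
  · have hz1 : ¬ IsRest H z i := fun hc => hz (Or.inl hc)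
    have hz2 : ¬ IsRest H (z + Pi.single j 1) i := fun hc => hz (Or.inr hc)
    rw [Kx_of_not_isRest_fst hz2, Kx_of_not_isRest_fst hz2, Kx_of_not_isRest_fst hz1, Kx_of_not_isRest_fst hz1]
    simp only [sub_zero, add_zero, abs_zero, zero_mul]
    positivity

end RestBlock

end Summit.QuantumFields.YangMills.Theorems.AllWindowsColdBoxBoxHighLine

end
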